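import Summits.CriticalPhenomena.PercolationContinuityZ3.Theorems.Transplant.SkelFrmFrom1ChoiceDefsPx
import Summits.CriticalPhenomena.PercolationContinuityZ3.Theorems.Transplant.SkelFrmFrom1ClosureLTKPx
import Summits.CriticalPhenomena.PercolationContinuityZ3.Theorems.Transplant.PlanarSkeletonFrmFromReflect
import HarnessLib

/-!
# GEN ROW (RULING D-Us, lead g21 V147b / Us-R1–R2 lead g22; WAVE-Us-MANIFEST v1.0 §3/§9, closure spine level 6 — THE GEN CLOSURE TOP) «SkelFrmFrom1ChoiceLTKPx» — the
# GENERALISED twin of «SkelFrmFrom1ChoiceLTK»'s `samePDropOfSkeletonFrmFrom₁_of_choiceFnNQLTK`: **the same-`p` drop AT ONE BASE TYPE WITH PROXIES from a GEN choice function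
# meeting the four column obligations** (`PlanarSkeletonFrmFrom.drop_of_choiceFnNQLTKPx_at`), shared-choice form, face target accuracy `dT`, K-floor `Kmin`

builds on p205010 (kernel theorem, internal audit signed; external expert review pending) — nothing in this file uses p205010; CONDITIONAL closure (hypotheses = a GEN choice
function AT PROXY RADIUS `D`, `𝒞₀ : ChoiceFnNQPxAt D`, with `GeomHoldsNQFnPxAt 𝒞₀`, `RootHoldsNQWFnLKPxAt Lf Kmin 𝒞₀`, `FaceHoldsRNQFnLTKPxAt Lf dT Kmin 𝒞₀`,
`ReachHoldsRHNQFnLKPxAt Lf Kmin 𝒞₀` — the four GEN column tops; the `…PxAt` forms of record of «SkelFrmFrom1ChoiceDefsPx» §2, `D` a parameter); NOTHING about the OPEN nodes U (`SamePDropOfSkeletonFrmFrom₁`) / U_s (`SamePDropOfSkeletonFrmScaled₁`) is claimed; no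
statement, no `@[conjecture]`, def-free.  Lane `prim-bschramm`, seat `prim-bschramm-gen-1` g0 (GEN pen); helper file (`--supports stmt-CriticalPhenomena-4575 --as helper`);
NON-VERBATIM new text in the GEN hunk class of WAVE-Us-MANIFEST §2 ((i) binder swap `(h1) ↦ (hP : Φ.HasProxies t D)`; (iii) seed floor — the instance hands `FactsNS … (max 𝒞.m₀ D) t`, read
DOWN to `FactsNS … 𝒞.m₀ t` for `AtQNQ` by `FactsNS.of_le`).
* §1 two transports the top needs and nothing below it did: `HasProxies.reflect` (proxies survive the coordinate reflections `Φ.reflect s` — same automorphism, same proxy,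
  the reflected chart is linear in the chart) and `OutNS.FactsNS.of_le` (the facts are antitone in the least seed level).
* §2 THE GEN CLOSURE TOP, pointwise: `drop_of_stepI_outNS_at` («…NormalisePx» p460849) ∘ (at each reflected skeleton `Φ.reflect s`, with `hP.reflect s`)
  `outNS_of_residuesNQLTK_at` («…ClosureLTKPx» p461641) ∘ the U top's instance text VERBATIM (`κ := ⟨K₀, δ, δ₂, δr, …⟩`, `𝒞 := 𝒞₀ κ G (Φ.reflect s) hg t ht (hP.reflect s) …`,
  `S_adm`, `AtQNQ`, the four obligations).  U's `samePDropOfSkeletonFrmFrom₁_of_choiceFnNQLTK` is the instance `types = {t}`, `D = 0`.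
U_s NODE SHAPE (Us-4, LEAD-GATED, not here): for a one-type scaled skeleton `Φs` with `L ≤ N`, apply §2 to `Φ := Φs.coarseFrmFrom h1 hLN` (part 5), `hP` from
`hasProxies_coarseFrmFrom` (this fixes `D`), `hC` from `coarseFrmFrom_cylSubcritical`, at the GEN choice function of record AT `D` («…BChoiceDefsVPx») and the four GEN
column tops at `D`.
[cite: KozmaNitzan2024, §4 Theorem 6 (pp. 25–31); §1 p. 2 (approach 1)] [cite: MartineauTassion2017, §3.2–3.3] [cite: BenjaminiSchramm1996, Conj. 4] [this work]
-/

noncomputable section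

open MeasureTheory ProbabilityTheory
open scoped ENNReal Classical

namespace Summit.CriticalPhenomena.PercolationContinuityZ3.Theorems.Transplant

open Literature.Probability.Percolation Literature.Probability.LatticeModels SimpleGraph KNCells KNLevels
open Literature.Barriers.CriticalPhenomena (HasExponentialGrowth graphBall)
open SkelConc (Consts)

/-! ## §1 Two transports -/

namespace Skelφ.StepI

variable {V : Type} {G : SimpleGraph V}

/-- **The facts with selectors are antitone in the least seed level**: `FactsNS … m₀ t` with `m₀' ≤ m₀` gives `FactsNS … m₀' t` (only the conjunct `m₀ ≤ k` reads it).
[folklore] -/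
theorem OutNS.FactsNS.of_le {φ : V → Site 2} {types : Finset V} [Countable V] [G.LocallyFinite] {hfr : Frames G φ types} {p : unitInterval}
    {hC : CylSubcritical G φ types p} {m₀ m₀' : ℕ} {t : V} {O : OutNS V} (h : O.FactsNS (G := G) hfr hC m₀ t) (hm : m₀' ≤ m₀) :
    O.FactsNS (G := G) hfr hC m₀' t :=
  ⟨⟨hm.trans h.1.1, h.1.2⟩, h.2⟩

end Skelφ.StepI

namespace PlanarSkeletonFrmFrom

variable {V : Type} {G : SimpleGraph V} [G.LocallyFinite]

/-- **Proxies survive the coordinate reflections**: `Φ.HasProxies t D → (Φ.reflect s).HasProxies t D` — the same automorphism and the same proxy serve, because the reflected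
chart `w ↦ (sᵢ φᵢ w)ᵢ` is coordinatewise linear in `φ` (so chart translations stay chart translations and equal positions stay equal) and the graph is unchanged. [folklore] -/
theorem HasProxies.reflect {Φ : PlanarSkeletonFrmFrom G} {t : V} {D : ℕ} (h : Φ.HasProxies t D) (s : Fin 2 → ℤˣ) : (Φ.reflect s).HasProxies t D := by
  intro c
  obtain ⟨c', α, hαt, hφ, hcell, hball⟩ := h c
  refine ⟨c', α, hαt, fun w => ?_, ?_, hball⟩
  · funext i
    simp only [reflect_φ, Pi.add_apply, Pi.sub_apply, hφ w]
    ring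
  · funext i
    simp only [reflect_φ, hcell]

/-! ## §2 The GEN closure top -/

/-- **THE GEN PARTIAL CLOSURE OF RECORD, pointwise, shared-choice form, face target accuracy `dT`, K-floor `Kmin`** (GEN twin of
`samePDropOfSkeletonFrmFrom₁_of_choiceFnNQLTK`).  Let `𝒞₀` be a GEN choice function at proxy radius `D` (`ChoiceFnNQPxAt D`: over every frames-only skeleton not of
exponential growth, at a base vertex WITH PROXIES at radius `D`) meeting the geometric obligation `GeomHoldsNQFnPxAt 𝒞₀` and — for every `κ` with `Kmin ≤ κ.K₀` — the forward
law-carrying root obligation given flatness `RootHoldsNQWFnLKPxAt Lf Kmin 𝒞₀`, the face obligation given flatness and the inner-chain fact at `dT κ.δ₂` (`0 < dT x` for `0 < x`)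
`FaceHoldsRNQFnLTKPxAt Lf dT Kmin 𝒞₀`, and the budgeted corridor obligation `ReachHoldsRHNQFnLKPxAt Lf Kmin 𝒞₀`.  Then for every locally finite countable `G` not of exponential growth with a `PlanarSkeletonFrmFrom Φ`, every
base vertex `t ∈ Φ.types` with proxies at radius `D` (`Φ.HasProxies t D`), and every `0 < p < 1` with a.s. uniqueness, Φ2 and `θ_t(p) > 0`, some `q < p` has `θ_t(q) > 0`.
(Proof: `drop_of_stepI_outNS_at`, and at each reflected skeleton `Φ.reflect s` — proxies by `HasProxies.reflect` — `outNS_of_residuesNQLTK_at` fed by `𝒞₀` at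
`κ := ⟨K₀, δ, δ₂, δr⟩` and the four obligations, the U top's text.) [cite: KozmaNitzan2024, §4 Theorem 6 (pp. 25–31); §1 p. 2] -/
theorem drop_of_choiceFnNQLTKPx_at (Lf : ℕ → ℕ) (dT : ℝ → ℝ) (hdT : ∀ x : ℝ, 0 < x → 0 < dT x) (Kmin : ℕ) {D : ℕ}
    (𝒞₀ : ChoiceFnNQPxAt D) (hGm : GeomHoldsNQFnPxAt 𝒞₀) (hR : RootHoldsNQWFnLKPxAt Lf Kmin 𝒞₀)
    (hF : FaceHoldsRNQFnLTKPxAt Lf dT Kmin 𝒞₀) (hRe : ReachHoldsRHNQFnLKPxAt Lf Kmin 𝒞₀)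
    [DecidableEq V] [Countable V] (Φ : PlanarSkeletonFrmFrom G) (hg : ¬ HasExponentialGrowth G) {t : V} (ht : t ∈ Φ.types) (hP : Φ.HasProxies t D)
    (p : unitInterval) (hp0 : 0 < (p : ℝ)) (hp1 : (p : ℝ) < 1) (hU : ∀ᵐ ω ∂bondPercolation G p, numInfiniteClusters ω ≤ 1) (hC : Φ.CylSubcritical p)
    (hθ : 0 < theta G t p) :
    ∃ q : unitInterval, (q : ℝ) < p ∧ 0 < theta G t q := by
  refine drop_of_stepI_outNS_at Φ ht D p hp0 hp1 hU hC hθ fun s => ?_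
  -- at the reflected skeleton `Φ.reflect s` (proxies transported), the residue-level step fed by the choice function
  have hCs : (Φ.reflect s).CylSubcritical p := (Φ.reflect_cylSubcritical_iff s p).2 hC
  have hPs : (Φ.reflect s).HasProxies t D := hP.reflect s
  refine outNS_of_residuesNQLTK_at Lf dT hdT Kmin (Φ.reflect s) t D p hp0 hp1 hCs
    fun K₀ δ δ₂ δr hKmin hδ0 hδ1 hδ₂0 hδ₂1 hδr hflat hCF => ?_
  set κ : Consts := ⟨K₀, δ, δ₂, δr, hδ0, hδ1, hδ₂0, hδ₂1, hδr⟩ with hκ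
  have hKmin' : Kmin ≤ κ.K₀ := hKmin
  have hflat' : FlatQ Lf κ := hflat
  have hCF' : ChainFactQT Lf G (Φ.reflect s).Δ κ (dT κ.δ₂) := hCF
  set 𝒞 := 𝒞₀ κ G (Φ.reflect s) hg t ht hPs p hp0 hp1 hCs with h𝒞
  refine ⟨𝒞.δI, 𝒞.m₀, 𝒞.δI_pos, 𝒞.δI_lt_one, fun O hfacts => ?_⟩
  -- the seed floor `max 𝒞.m₀ D` handed by the closure, read down to `𝒞.m₀` for `AtQNQ`
  have hfacts' : O.FactsNS (G := G) (Φ.reflect s).frame hCs 𝒞.m₀ t := hfacts.of_le (le_max_left _ _)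
  obtain ⟨hSz, hSMn⟩ := 𝒞.S_adm O hfacts'
  refine ⟨𝒞.Sz O, 𝒞.SMn O, hSz, hSMn, fun q hq1 hq2 hin hCq => ?_⟩
  have hat : 𝒞.AtQNQ O q := ⟨hfacts', hq1, hq2, hin, hCq⟩
  obtain ⟨hroot, hK, hrun, hanch, hsep, hexit, hsteps, hlev⟩ := hGm κ G (Φ.reflect s) hg t ht hPs p hp0 hp1 hCs O q hat
  obtain ⟨nmax, hnmax, hreach⟩ := hRe κ G (Φ.reflect s) hg t ht hPs p hp0 hp1 hCs hKmin' O q hat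
  exact ⟨𝒞.Γ O q, 𝒞.FD O q, 𝒞.LD O q, hroot, hK, hrun, hanch, hsep, hexit, hsteps, hlev,
    hR κ G (Φ.reflect s) hg t ht hPs p hp0 hp1 hCs hKmin' hflat' O q hat,
    hF κ G (Φ.reflect s) hg t ht hPs p hp0 hp1 hCs hKmin' hflat' hCF' O q hat, nmax, hnmax, hreach⟩

end PlanarSkeletonFrmFrom

end Summit.CriticalPhenomena.PercolationContinuityZ3.Theorems.Transplant

end
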